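import Summits.NavierStokesRegularity.FluidComputer.RowSection
import HarnessLib

/-!
# `RowSectionSpan`: the box-form section read-out over a window of SEVERAL consecutive rows
# (`pub-fluidc-bp3/R1-DESIGN.md` §15; kernel twin `code/thgate/g26/section26.py`)

HONEST FRAMING (cell `pub-fluidc`, blueprint seat bp3, gen 26): low prior, high value-of-information
experiment on Tao's machine paradigm; NOT a claim that NS blows up. Bookkeeping only, no fluid
mechanics.

WHAT. `RowSection.sectionOK rB rF c` (in tree, gen 23) reads the member out at its own crossing of
the section `π(v) := v_{b₂} − ρ v_{a₂} = 0` inside a window of exactly TWO rows: (S1) every member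
is below the section when the window opens, (S2) above it when it closes, (S3) on every sub-interval
of either row where a crossing is possible the level-normalised read-outs land in the induction box
`ctr ± wid`. Under a perturbation class the carrier dispersion `Ē_{a₂}` at the end of the chain
grows and (S1) on the two-row window is the FIRST test to fail (R1-DESIGN §14.3 (b)), although it is
an artefact of the window's length, not of the box: opening the window one row earlier makes `π̂` at
the opening instant several times more negative. **`sectionOKspan rs n c`** is the same certificate
over the `n + 1` consecutive rows `rs 0, …, rs n` (S1 on `rs 0`, S2 on `rs n`, S3 and the lock
coordinate `Ē_{b₂} = 0` on every row), and **`section_sound_span`** its soundness: a member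
continuous in phase time on each row and inside each row's tube crosses the section somewhere in `[T
0, T (n+1)]` with positive carrier, level in `[levLo, levHi]` and read-outs in the box (IVT row by
row: the first row whose end value of `π` is non-negative carries the crossing).
`sectionOKspan_pair`: on two rows the span certificate is implied by the in-tree one, so nothing
certified so far is weakened. Generic over `RowData`; no `native_decide`; the instantiation on a
chain is a one-line `native_decide` elsewhere.

[cite: Tao2016AveragedNS, §5.5 Thm 5.3 (5.5)]
-/

namespace Summit.NavierStokesRegularity.FluidComputer

open Literature.Analysis.FluidPDE.FluidComputer

namespace RowCheck

open DIVec ChainField Set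

/-- **The section read-out certificate over a window of `n + 1` consecutive rows** `rs 0, …, rs n`:
positivity of `M`, `ρ`; on every window row `0 < H`, all `M` pieces pass (S3) and `b₂` is the lock
coordinate; (S1) on the first row; (S2) on the last. [folklore] -/
def sectionOKspan (rs : ℕ → RowData) (n : ℕ) (c : SecCert) : Bool :=
  decide (0 < c.M) && decide (0 < c.rho) &&
    (List.range (n + 1)).all (fun i =>
      decide (0 < (rs i).Hq) && (rs i).piecesOK c && decide ((rs i).Eb 5 = 0)) &&
    (rs 0).secStartOK c && (rs n).secEndOK c

/-- The two-row certificate of record implies the span certificate on the same two rows (`rs 0 =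
rB`, `rs 1 = rF`). [folklore] -/
theorem sectionOKspan_pair {rB rF : RowData} {c : SecCert} (h : sectionOK rB rF c = true)
    (rs : ℕ → RowData) (h0 : rs 0 = rB) (h1 : rs 1 = rF) : sectionOKspan rs 1 c = true := by
  simp only [sectionOK, Bool.and_eq_true, decide_eq_true_eq] at h
  obtain ⟨⟨⟨⟨⟨⟨⟨hM, hrho⟩, hHB⟩, hHF⟩, hS1⟩, hS2⟩, hPB⟩, hPF⟩ := h
  have h5B : rB.Eb 5 = 0 := by
    simp only [RowData.secStartOK, Bool.and_eq_true, decide_eq_true_eq] at hS1; exact hS1.2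
  have h5F : rF.Eb 5 = 0 := by
    simp only [RowData.secEndOK, Bool.and_eq_true, decide_eq_true_eq] at hS2; exact hS2.2
  simp only [sectionOKspan, Bool.and_eq_true, decide_eq_true_eq, List.all_eq_true, List.mem_range]
  refine ⟨⟨⟨⟨hM, hrho⟩, fun i hi => ?_⟩, by rw [h0]; exact hS1⟩, by rw [h1]; exact hS2⟩
  interval_cases i
  · rw [h0]; exact ⟨⟨hHB, hPB⟩, h5B⟩
  · rw [h1]; exact ⟨⟨hHF, hPF⟩, h5F⟩

/-- **Soundness of the span certificate.** Window rows `rs 0, …, rs n` occupy the phase-time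
intervals `[T i, T (i+1)]`, `T (i+1) = T i + H_i`; the member `v` is continuous on each and inside
each row's tube. Then it crosses the section `v_{b₂} = ρ v_{a₂}` at some instant of `[T 0, T
(n+1)]`, and there the carrier is positive, the level `v_{b₂}/bmid` lies in `[levLo, levHi]` and the
three read-out ratios lie in the induction box `ctr ± wid`. [folklore] -/
theorem section_sound_span {rs : ℕ → RowData} {n : ℕ} {c : SecCert}
    (h : sectionOKspan rs n c = true) {v : ℝ → Fin 9 → ℝ} {T : ℕ → ℝ}
    (hT : ∀ i ≤ n, T (i + 1) = T i + (rs i).Hq)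
    (hc : ∀ i ≤ n, ContinuousOn v (Icc (T i) (T (i + 1))))
    (ht : ∀ i ≤ n, ∀ t ∈ Icc (T i) (T (i + 1)), ∀ a,
      |v t a - xh (rs i).CQ (t - T i) a| ≤ (rs i).EbarR a) :
    ∃ t ∈ Icc (T 0) (T (n + 1)), v t 5 = c.rho * v t 4 ∧ 0 < v t 4 ∧
      ((c.levLo : ℝ) ≤ v t 5 / c.bmid ∧ v t 5 / c.bmid ≤ c.levHi) ∧
      ∀ j : Fin 3, |(c.bmid : ℝ) * v t (rdIdx j) / v t 5 - c.ctr j| ≤ c.wid j := by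
  simp only [sectionOKspan, Bool.and_eq_true, decide_eq_true_eq, List.all_eq_true,
    List.mem_range] at h
  obtain ⟨⟨⟨⟨hM, hrho⟩, hrows⟩, hS1⟩, hS2⟩ := h
  have hrho' : (0 : ℝ) < c.rho := by exact_mod_cast hrho
  have hH : ∀ i ≤ n, (0 : ℝ) < (rs i).Hq := fun i hi => by
    exact_mod_cast (hrows i (Nat.lt_succ_of_le hi)).1.1
  have hP : ∀ i ≤ n, (rs i).piecesOK c = true := fun i hi => (hrows i (Nat.lt_succ_of_le hi)).1.2
  have h5 : ∀ i ≤ n, (rs i).Eb 5 = 0 := fun i hi => (hrows i (Nat.lt_succ_of_le hi)).2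
  -- the times increase
  have hstep : ∀ i ≤ n, T i ≤ T (i + 1) := fun i hi => by rw [hT i hi]; linarith [hH i hi]
  have hmono : ∀ i j, i ≤ j → j ≤ n + 1 → T i ≤ T j := by
    intro i j hij hj
    induction j with
    | zero => simp at hij; rw [hij]
    | succ j ih =>
      rcases Nat.lt_or_ge i (j + 1) with hlt | hge
      · exact (ih (Nat.le_of_lt_succ hlt) (by omega)).trans (hstep j (by omega))
      · have : i = j + 1 := le_antisymm hij hge
        rw [this]
  -- the section function in phase time
  set f : ℝ → ℝ := fun t => v t 5 - c.rho * v t 4 with hf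
  have hfc : ∀ {a b : ℝ}, ContinuousOn v (Icc a b) → ContinuousOn f (Icc a b) := fun hcv =>
    ((continuous_apply 5).comp_continuousOn hcv).sub
      (((continuous_apply 4).comp_continuousOn hcv).const_smul (c.rho : ℝ) |>.congr
        (fun t _ => by simp [smul_eq_mul]))
  have hf0 : f (T 0) < 0 := by
    have := ht 0 (Nat.zero_le n) (T 0) ⟨le_rfl, hstep 0 (Nat.zero_le n)⟩
    simp only [sub_self] at this
    exact RowData.secStart_sound hS1 hrho this
  have hfE : 0 < f (T (n + 1)) := by
    have := ht n le_rfl (T (n + 1)) ⟨hstep n le_rfl, le_rfl⟩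
    rw [show T (n + 1) - T n = (rs n).Hq by rw [hT n le_rfl]; ring] at this
    exact RowData.secEnd_sound hS2 hrho this
  -- conclusion from a crossing inside row `i`
  have concl : ∀ i ≤ n, ∀ t ∈ Icc (T i) (T (i + 1)), f t = 0 →
      ∃ t ∈ Icc (T 0) (T (n + 1)), v t 5 = c.rho * v t 4 ∧ 0 < v t 4 ∧
        ((c.levLo : ℝ) ≤ v t 5 / c.bmid ∧ v t 5 / c.bmid ≤ c.levHi) ∧
        ∀ j : Fin 3, |(c.bmid : ℝ) * v t (rdIdx j) / v t 5 - c.ctr j| ≤ c.wid j := by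
    intro i hi t htI hft
    have hsec : v t 5 = c.rho * v t 4 := by
      have : f t = v t 5 - c.rho * v t 4 := rfl
      linarith
    have hu : t - T i ∈ Icc 0 ((rs i).Hq : ℝ) :=
      ⟨by linarith [htI.1], by rw [hT i hi] at htI; linarith [htI.2]⟩
    obtain ⟨hv5, hlev, hrat⟩ :=
      RowData.pieces_sound (hP i hi) hM (by exact_mod_cast hH i hi) hrho (h5 i hi) hu
        (ht i hi t htI) hsec
    refine ⟨t, ⟨(hmono 0 i (Nat.zero_le i) (by omega)).trans htI.1,
      htI.2.trans (hmono (i + 1) (n + 1) (by omega) le_rfl)⟩, hsec, ?_, hlev, hrat⟩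
    nlinarith
  -- the first row whose end value is non-negative carries the crossing (induction on the rows left)
  have key : ∀ j k : ℕ, k + j = n → f (T k) < 0 →
      ∃ t ∈ Icc (T 0) (T (n + 1)), v t 5 = c.rho * v t 4 ∧ 0 < v t 4 ∧
        ((c.levLo : ℝ) ≤ v t 5 / c.bmid ∧ v t 5 / c.bmid ≤ c.levHi) ∧
        ∀ j : Fin 3, |(c.bmid : ℝ) * v t (rdIdx j) / v t 5 - c.ctr j| ≤ c.wid j := by
    intro j
    induction j with
    | zero =>
      intro k hk hfk
      have hkn : k = n := by omega
      subst hkn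
      obtain ⟨t, htI, hft⟩ : ∃ t ∈ Icc (T k) (T (k + 1)), f t = 0 :=
        intermediate_value_Icc (hstep k le_rfl) (hfc (hc k le_rfl)) ⟨hfk.le, hfE.le⟩
      exact concl k le_rfl t htI hft
    | succ j ih =>
      intro k hk hfk
      have hkn : k ≤ n := by omega
      by_cases hmid : 0 ≤ f (T (k + 1))
      · obtain ⟨t, htI, hft⟩ : ∃ t ∈ Icc (T k) (T (k + 1)), f t = 0 :=
          intermediate_value_Icc (hstep k hkn) (hfc (hc k hkn)) ⟨hfk.le, hmid⟩
        exact concl k hkn t htI hft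
      · push Not at hmid
        exact ih (k + 1) (by omega) hmid
  exact key n 0 (by omega) hf0

end RowCheck

end Summit.NavierStokesRegularity.FluidComputer
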